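import Mathlib.RingTheory.LocalRing.Module
import Mathlib.RingTheory.Localization.FractionRing
import Mathlib.LinearAlgebra.FiniteDimensional.Lemmas
import HarnessLib

/-!
# A finite module over a local domain whose closed-fibre rank does not exceed its generic rank is free

Topic `Algebra/Module`; namespace `Literature.Algebra.Module`; a *proofs* file (theorems only,
Mathlib-only imports).  For a LOCAL DOMAIN `R` with residue field `κ` and fraction field `K`, and a finitely
generated `R`-module `M`:

* `nonempty_basis_of_finrank_residueField_le` / `free_of_finrank_residueField_le` — if
  `dim_κ (κ ⊗_R M) ≤ dim_K (K ⊗_R M)` then `M` is FREE, of rank `dim_κ (κ ⊗_R M) = dim_K (K ⊗_R M)`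
  (`finrank_eq_finrank_residueField_of_le`, `finrank_fractionRing_tensor_eq_of_le`).

The opposite inequality `dim_K (K ⊗ M) ≤ dim_κ (κ ⊗ M)` always holds (upper semicontinuity of the fibre rank), so
the hypothesis says the two fibre ranks are EQUAL; no flatness and no noetherian hypothesis is used (contrast Mathlib's
`Module.free_of_flat_of_finrank_eq`, `Module.free_of_flat_of_isLocalRing`, which assume `M` flat; and compare the
tree's `Literature.Algebra.Module.FreenessCriterion.free_and_finrank_eq` (`FreenessByRankCount.lean`: the same
criterion for a local `R`-ALGEBRA `A` finite free over a domain `R`, with the generic rank measured by `finrank R M` —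
this file is the `A = R` case restated in the residue-field / fraction-field currency its geometric consumer needs,
with a self-contained proof).  Proof (Matsumura, Thm. 2.3 = Nakayama, and the rank count of §7 / Thm. 4.10): lift a `κ`-basis of `κ ⊗ M` to `n`
elements of `M`; by Nakayama they generate (`IsLocalRing.span_eq_top_of_tmul_eq_basis`), giving `Rⁿ ↠ M`; after
`K ⊗_R −` the `n` images span a `K`-space of dimension `≥ n`, hence are `K`-independent, and a relation in `Rⁿ` maps
to a relation in `Kⁿ` under the injective `R → K`, so it vanishes.

USE (cell `hodgecm-mathlib`, E2 line, P1-AV core, A-p11; zero `HC_CM` currency by itself): the conormal module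
`I/I²` of the unit section of a smooth proper model over `𝓞_{k,𝔓}` has both fibre ranks equal to `g` (the dimension of
the generic and of the special fibre), hence is free of rank `g`, so that ONE characteristic polynomial over `𝓞_{k,𝔓}`
specialises to the cotangent characteristic polynomials of both fibres.

## References
* H. Matsumura, *Commutative Ring Theory*, Cambridge Studies in Advanced Mathematics 8 (1986), Theorem 2.3
  (Nakayama's lemma) and Theorem 4.10 with its proof (minimal bases over local rings; freeness from rank).
  [cite: Matsumura1987, Thm. 2.3 and §7]
* The Stacks project, Tag 02M9 (the flat variant; Mathlib `Module.free_of_flat_of_finrank_eq`).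
-/

noncomputable section

open TensorProduct IsLocalRing Module

namespace Literature.Algebra.Module

variable (R : Type*) [CommRing R] [IsDomain R] [IsLocalRing R]
variable (M : Type*) [AddCommGroup M] [Module R M] [Module.Finite R M]
variable (K : Type*) [Field K] [Algebra R K] [IsFractionRing R K]

/-- **A residue basis lifts to a basis** when the generic rank is at least the closed-fibre rank: for a finite
module `M` over a local domain `R` with `dim_κ (κ ⊗ M) ≤ dim_K (K ⊗ M)`, `M` has a basis indexed by
`Fin (dim_κ (κ ⊗ M))` (Nakayama + a dimension count on the generic fibre; no flatness assumed).
[cite: Matsumura1987, Thm. 2.3 and §7] -/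
theorem nonempty_basis_of_finrank_residueField_le
    (h : finrank (ResidueField R) (ResidueField R ⊗[R] M) ≤ finrank K (K ⊗[R] M)) :
    Nonempty (Basis (Fin (finrank (ResidueField R) (ResidueField R ⊗[R] M))) R M) := by
  classical
  set n := finrank (ResidueField R) (ResidueField R ⊗[R] M) with hn
  -- a residue basis and a lift of it to `M`
  let b' : Basis (Fin n) (ResidueField R) (ResidueField R ⊗[R] M) := Module.finBasisOfFinrankEq _ _ rfl
  have hsurj := TensorProduct.mk_surjective R M (ResidueField R) Ideal.Quotient.mk_surjective
  choose b hb using fun i => hsurj (b' i)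
  -- Nakayama: the lift generates `M`, i.e. `f : Rⁿ → M` is onto
  have hspan : Submodule.span R (Set.range b) = ⊤ :=
    IsLocalRing.span_eq_top_of_tmul_eq_basis b b' fun i => hb i
  let f : (Fin n → R) →ₗ[R] M := Fintype.linearCombination R b
  have hf : Function.Surjective f := by
    rw [← LinearMap.range_eq_top, Fintype.range_linearCombination, hspan]
  -- `1 ⊗ f c = Σ c i • (1 ⊗ b i)` in `K ⊗ M`
  have hone : ∀ c : Fin n → R,
      (1 : K) ⊗ₜ[R] f c = ∑ i, algebraMap R K (c i) • ((1 : K) ⊗ₜ[R] b i) := by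
    intro c
    simp only [f, Fintype.linearCombination_apply, tmul_sum, tmul_smul, algebraMap_smul]
  -- the `K`-linear combination map on the generic fibre is onto
  let g : (Fin n → K) →ₗ[K] K ⊗[R] M := Fintype.linearCombination K fun i => (1 : K) ⊗ₜ[R] b i
  have hg_surj : Function.Surjective g := by
    rw [← LinearMap.range_eq_top, Fintype.range_linearCombination, eq_top_iff]
    rintro t -
    induction t using TensorProduct.induction_on with
    | zero => exact zero_mem _
    | add x y hx hy => exact add_mem hx hy
    | tmul x m =>
      obtain ⟨c, rfl⟩ := hf m
      have hx : x ⊗ₜ[R] f c = x • ((1 : K) ⊗ₜ[R] f c) := by rw [smul_tmul', smul_eq_mul, mul_one]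
      rw [hx, hone]
      exact Submodule.smul_mem _ x
        (Submodule.sum_mem _ fun i _ => Submodule.smul_mem _ _ (Submodule.subset_span ⟨i, rfl⟩))
  -- dimension count: `dim_K (K ⊗ M) = n`, so `g` is injective
  haveI : FiniteDimensional K (K ⊗[R] M) := Module.Finite.of_surjective g hg_surj
  have hle : finrank K (K ⊗[R] M) ≤ n := by
    have h1 := LinearMap.finrank_range_le g
    rwa [LinearMap.range_eq_top.2 hg_surj, finrank_top, Module.finrank_fin_fun] at h1
  have hdim : finrank K (Fin n → K) = finrank K (K ⊗[R] M) := by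
    rw [Module.finrank_fin_fun]
    exact le_antisymm h hle
  have hg_inj : Function.Injective g :=
    (LinearMap.injective_iff_surjective_of_finrank_eq_finrank hdim).2 hg_surj
  -- `f` is injective: a relation maps to a `K`-relation under the injective `R → K`
  have hf_inj : Function.Injective f := by
    rw [← LinearMap.ker_eq_bot, LinearMap.ker_eq_bot']
    intro c hc
    have hgc : g (fun i => algebraMap R K (c i)) = 0 := by
      have h0 : (1 : K) ⊗ₜ[R] f c = 0 := by rw [hc, tmul_zero]
      rw [hone] at h0
      simpa only [g, Fintype.linearCombination_apply] using h0
    have hc0 : (fun i => algebraMap R K (c i)) = 0 := hg_inj (by rw [hgc, map_zero])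
    funext i
    exact IsFractionRing.injective R K (by simpa using congr_fun hc0 i)
  exact ⟨(Pi.basisFun R (Fin n)).map (LinearEquiv.ofBijective f ⟨hf_inj, hf⟩)⟩

/-- **Freeness from fibre-rank comparison** (no flatness): a finite module `M` over a local domain `R` with
`dim_κ (κ ⊗_R M) ≤ dim_K (K ⊗_R M)` is free. [cite: Matsumura1987, Thm. 2.3 and §7] -/
theorem free_of_finrank_residueField_le
    (h : finrank (ResidueField R) (ResidueField R ⊗[R] M) ≤ finrank K (K ⊗[R] M)) : Module.Free R M :=
  let ⟨b⟩ := nonempty_basis_of_finrank_residueField_le R M K h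
  Module.Free.of_basis b

/-- Under the fibre-rank hypothesis, `rank_R M = dim_κ (κ ⊗_R M)`. [cite: Matsumura1987, Thm. 2.3 and §7] -/
theorem finrank_eq_finrank_residueField_of_le
    (h : finrank (ResidueField R) (ResidueField R ⊗[R] M) ≤ finrank K (K ⊗[R] M)) :
    finrank R M = finrank (ResidueField R) (ResidueField R ⊗[R] M) := by
  obtain ⟨b⟩ := nonempty_basis_of_finrank_residueField_le R M K h
  rw [finrank_eq_card_basis b, Fintype.card_fin]

/-- Under the fibre-rank hypothesis the two fibre ranks are equal: `dim_K (K ⊗_R M) = dim_κ (κ ⊗_R M)`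
(the generic rank never exceeds the closed-fibre rank). [cite: Matsumura1987, Thm. 2.3 and §7] -/
theorem finrank_fractionRing_tensor_eq_of_le
    (h : finrank (ResidueField R) (ResidueField R ⊗[R] M) ≤ finrank K (K ⊗[R] M)) :
    finrank K (K ⊗[R] M) = finrank (ResidueField R) (ResidueField R ⊗[R] M) := by
  obtain ⟨b⟩ := nonempty_basis_of_finrank_residueField_le R M K h
  haveI : Module.Free R M := Module.Free.of_basis b
  rw [Module.finrank_baseChange, finrank_eq_card_basis b, Fintype.card_fin]

/-! ## Any residue algebra `R ↠ κ'` in place of `ResidueField R` -/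

variable (κ' : Type*) [Field κ'] [Algebra R κ']

omit [IsDomain R] [Module.Finite R M] in
/-- For a surjection `R ↠ κ'` onto a field (necessarily with kernel the maximal ideal), the fibre rank over `κ'` is
the residue-field fibre rank: `dim_{κ'} (κ' ⊗_R M) = dim_κ (κ ⊗_R M)`. [cite: Matsumura1987, Thm. 2.3 and §7] -/
theorem finrank_tensor_eq_finrank_residueField_tensor (hκ : Function.Surjective (algebraMap R κ')) :
    finrank κ' (κ' ⊗[R] M) = finrank (ResidueField R) (ResidueField R ⊗[R] M) := by
  have hker : RingHom.ker (algebraMap R κ') = maximalIdeal R :=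
    IsLocalRing.eq_maximalIdeal (RingHom.ker_isMaximal_of_surjective _ hκ)
  let e : ResidueField R ≃+* κ' :=
    (Ideal.quotEquivOfEq hker.symm).trans (RingHom.quotientKerEquivOfSurjective hκ)
  letI : Algebra (ResidueField R) κ' := e.toRingHom.toAlgebra
  haveI : IsScalarTower R (ResidueField R) κ' := by
    refine IsScalarTower.of_algebraMap_eq fun r => ?_
    exact (RingHom.quotientKerEquivOfSurjective_apply_mk hκ r).symm
  rw [← (AlgebraTensorModule.cancelBaseChange R (ResidueField R) κ' κ' M).finrank_eq,
    Module.finrank_baseChange]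

/-- **Freeness from fibre-rank comparison, residue-algebra form**: for a surjection `R ↠ κ'` onto a field and a
finite module `M` over the local domain `R`, `dim_{κ'} (κ' ⊗_R M) ≤ dim_K (K ⊗_R M)` implies `M` free.
[cite: Matsumura1987, Thm. 2.3 and §7] -/
theorem free_of_finrank_le_of_surjective (hκ : Function.Surjective (algebraMap R κ'))
    (h : finrank κ' (κ' ⊗[R] M) ≤ finrank K (K ⊗[R] M)) : Module.Free R M :=
  free_of_finrank_residueField_le R M K ((finrank_tensor_eq_finrank_residueField_tensor R M κ' hκ) ▸ h)

/-- Residue-algebra form of the rank identity: `rank_R M = dim_{κ'} (κ' ⊗_R M)`.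
[cite: Matsumura1987, Thm. 2.3 and §7] -/
theorem finrank_eq_finrank_tensor_of_le_of_surjective (hκ : Function.Surjective (algebraMap R κ'))
    (h : finrank κ' (κ' ⊗[R] M) ≤ finrank K (K ⊗[R] M)) : finrank R M = finrank κ' (κ' ⊗[R] M) := by
  rw [finrank_tensor_eq_finrank_residueField_tensor R M κ' hκ] at h ⊢
  exact finrank_eq_finrank_residueField_of_le R M K h

/-- Residue-algebra form of the fibre-rank equality: `dim_K (K ⊗_R M) = dim_{κ'} (κ' ⊗_R M)`.
[cite: Matsumura1987, Thm. 2.3 and §7] -/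
theorem finrank_fractionRing_tensor_eq_of_le_of_surjective (hκ : Function.Surjective (algebraMap R κ'))
    (h : finrank κ' (κ' ⊗[R] M) ≤ finrank K (K ⊗[R] M)) :
    finrank K (K ⊗[R] M) = finrank κ' (κ' ⊗[R] M) := by
  rw [finrank_tensor_eq_finrank_residueField_tensor R M κ' hκ] at h ⊢
  exact finrank_fractionRing_tensor_eq_of_le R M K h

end Literature.Algebra.Module

end
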